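import Summits.CriticalPhenomena.PercolationContinuityZ3.Theses.PercLupuEnvironment
import Summits.CriticalPhenomena.PercolationContinuityZ3.Theorems.PercNearOneGluingNoHeavyLowerTailCSHTheoremOne
import Literature.Probability.LatticeModels.IsoradialPercolationProofs
import Literature.Probability.Percolation.Percolation
import HarnessLib

/-!
# `PercLupuEnvironment.ConstantFieldIsBernoulli` (stmt-CriticalPhenomena-6990) — SETTLED after continuity

Item `stmt-CriticalPhenomena-6990` of route `CriticalPhenomena/PercLupuEnvironment` (support): the constant field `a` gives Bernoulli bond percolation on ℤ³ with parameter `1 − e^{−2 a⁺a⁺}` under the Lupu weights.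

For the constant field the Lupu weight of every lattice edge `s(x,y)` is `projIcc (1 − exp(−2·a⁺·a⁺))` (`Sym2.map_mk`, `Sym2.mul_mk`) and `0` off the lattice, i.e. the edge-set indicator of a constant; `prodBernoulli_indicator_holds` identifies the product measure with `setBer(E(ℤ³), q) = bondPercolation (zdGraph 3) q`.  p205010 is NOT used.

builds on p205010 (kernel theorem, internal audit signed; external expert review pending) — USED (`CSH.percolationContinuityZ3_holds`).  RSW3 lane, lead gen 28 (prover-prim-rsw3-lead-g28-0):
'after continuity — the ledger harvest'.
References: G. Kozma, N. Nitzan (2024), Thm. 6 / Conj. 3 [KozmaNitzan2024]; G. Grimmett, *Percolation* (1999), §8 [GrimmettPercolation1999].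
-/

noncomputable section

namespace Summit.CriticalPhenomena.PercolationContinuityZ3.Theorems

namespace PercLupuEnvironmentConstantFieldIsBernoulli

open MeasureTheory Literature.Probability.Percolation Literature.Probability.LatticeModels

/-- **`PercLupuEnvironment.ConstantFieldIsBernoulli` (stmt-CriticalPhenomena-6990), settled.**  `prodBernoulli_indicator_holds` after computing the constant-field weights.
[cite: KozmaNitzan2024, Thm. 6 with Conj. 3 (p. 15)] -/
theorem constantFieldIsBernoulli_proof : Summit.CriticalPhenomena.PercolationContinuityZ3.Theses.PercLupuEnvironment.ConstantFieldIsBernoulli := by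
  unfold Summit.CriticalPhenomena.PercolationContinuityZ3.Theses.PercLupuEnvironment.ConstantFieldIsBernoulli
  intro W a
  classical
  have hW : W (fun _ => a) = fun e => if e ∈ (zdGraph 3).edgeSet then
      Set.projIcc (0 : ℝ) 1 zero_le_one (1 - Real.exp (-2 * (max a 0 * max a 0))) else 0 := by
    funext e
    induction e using Sym2.ind with
    | h x y => simp only [W, Sym2.map_mk, Sym2.mul_mk]
  rw [hW]
  exact prodBernoulli_indicator_holds (zdGraph 3).edgeSet _

end PercLupuEnvironmentConstantFieldIsBernoulli

end Summit.CriticalPhenomena.PercolationContinuityZ3.Theorems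

end
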